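import Mathlib
import HarnessLib
import Summits.Ventures.LatticeQCDFlow.Exactness.IMHCommonRandomNumbersPathObservables
import Summits.Ventures.LatticeQCDFlow.Scaling.AutoregressiveGaugeHeatBathColdExact

/-!
# LatticeQCDFlow / Scaling — the coupling inequality for the exact one-plaquette heat-bath sampler (`A = Z/(c^{#B}M^k)`): every bounded statistic of the whole future after `b` updates differs between the two coupled runs by at most `(1 − A)^b·P(U_0 ≠ U′_0)` times its range, and between two arbitrary starts by at most `(1 − A)^b·μ̂₀(Δᶜ)` times its range for every coupling `μ̂₀` (Hausdorff `G`)

HONEST FRAMING: exact (Metropolis-corrected) sampling algorithms for lattice gauge theory;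
figures of merit are autocorrelation/cost numbers at stated couplings and volumes; no
continuum-physics claim.

Venture `LatticeQCDFlow` (cell pub-lqcd), topic `Scaling`, FANOUT row 30 (lean-1, GEN-38) — OUR WORK, the gauge instance of this
generation's abstract `Exactness/IMHCommonRandomNumbersPathObservables` for the exact one-plaquette heat-bath sampler (`A = Z/(c^{#B}M^k)`).  Setting as in
`Scaling/AutoregressiveGauge…CommonRandomNumbers` (GEN-36): the CRN pair kernel `K̂` feeds the SAME proposals and uniforms to two runs;
`A` is the sampler's acceptance at the cold configuration (displayed), `1/A` its cold weight.
For every measurable path statistic `a ≤ F ≤ c` (window averages, autocovariance ∕ `τ_int` estimators, histograms, running extrema):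

* **`heatBath_crn_path_statistic_diff_le`** — on the pair path law of two runs fed the same random numbers, `E|F(U_{b+·}) − F(U′_{b+·})| ≤ (1 − A)^b·P(U_0 ≠ U′_0)·(c − a)`;
* **`heatBath_crn_path_statistic_sq_diff_le`** — `E(F(U_{b+·}) − F(U′_{b+·}))² ≤ (1 − A)^b·P(U_0 ≠ U′_0)·(c − a)²`;
* **`heatBath_coupling_inequality`** — THE COUPLING INEQUALITY: for every probability law `μ̂₀` on pairs of configurations, the two runs of the sampler
  from its marginals satisfy `|E F(U_{b+·}) − E F(V_{b+·})| ≤ (1 − A)^b·μ̂₀(Δᶜ)·(c − a)` — a perturbation of probability `p` is forgotten by every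
  future statistic at the rate `(1 − A)^b·p`.

NOT CLAIMED: the infimum over couplings (the set-wise total-variation form is GEN-37`s `…PathTotalVariationContraction`); any value of `A`.  No `def`, no `sorry`, nothing cited as a fact.
-/

noncomputable section

namespace Summit.Ventures.LatticeQCDFlow.Theory2.Autoregressive

open MeasureTheory ProbabilityTheory Function Finset
open scoped ENNReal unitInterval
open Literature.MathematicalPhysics.QuantumFieldTheory Literature.MathematicalPhysics.QuantumLattice
open Summit.Ventures.LatticeQCDFlow.Exactness Summit.Ventures.LatticeQCDFlow.Scoring

variable {d L : ℕ} [NeZero L] {G : Type*} [Group G] [TopologicalSpace G] [IsTopologicalGroup G]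
  [CompactSpace G] [SecondCountableTopology G] [MeasurableSpace G] [BorelSpace G]

/-- **`E|F(U_{b+·}) − F(U′_{b+·})| ≤ (1 − A)^b·P(U_0 ≠ U′_0)·(c − a)`** on the pair path law (the exact one-plaquette heat-bath sampler (`A = Z/(c^{#B}M^k)`); Hausdorff `G`). [ours] -/
theorem heatBath_crn_path_statistic_diff_le [T2Space G] [MeasurableSingletonClass G] (hL : 2 ≤ L) {w : G → ℝ} (hw : Continuous w) {m M : ℝ} (hm0 : 0 < m)
    (hm : ∀ g, m ≤ w g) (hM : ∀ g, w g ≤ M) (hw1 : w 1 = M)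
    (B : Finset (Plaquette d L)) (t : Plaquette d L → Edge d L)
    (ht : ∀ p ∈ B, t p ∈ ({(p.1, p.2.1.1), (p.1.shift p.2.1.1, p.2.1.2),
        (p.1.shift p.2.1.2, p.2.1.1), (p.1, p.2.1.2)} : Finset (Edge d L)))
    (rank : Plaquette d L → ℕ)
    (hrank : ∀ p ∈ B, ∀ p' ∈ B, p ≠ p' → t p ∈ ({(p'.1, p'.2.1.1), (p'.1.shift p'.2.1.1, p'.2.1.2),
        (p'.1.shift p'.2.1.2, p'.2.1.1), (p'.1, p'.2.1.2)} : Finset (Edge d L)) → rank p < rank p')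
    (π q : Measure (GaugeConfig d L G)) [IsProbabilityMeasure π] [IsProbabilityMeasure q]
    (hπ : π = (Measure.pi fun _ : Edge d L => haarProbability G).withDensity fun U =>
      ENNReal.ofReal ((∏ p : Plaquette d L, w (plaquetteHolonomy U p.1 p.2.1.1 p.2.1.2)) /
        ∫ V, ∏ p : Plaquette d L, w (plaquetteHolonomy V p.1 p.2.1.1 p.2.1.2)
          ∂(Measure.pi fun _ : Edge d L => haarProbability G)))
    (hq : q = (Measure.pi fun _ : Edge d L => haarProbability G).withDensity fun U =>
      ENNReal.ofReal ((∏ p ∈ B, w (plaquetteHolonomy U p.1 p.2.1.1 p.2.1.2)) /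
        ∫ V, ∏ p ∈ B, w (plaquetteHolonomy V p.1 p.2.1.1 p.2.1.2)
          ∂(Measure.pi fun _ : Edge d L => haarProbability G)))
    [Fact (Measurable (fun U =>
        ((∫ V, ∏ p : Plaquette d L, w (plaquetteHolonomy V p.1 p.2.1.1 p.2.1.2) ∂(Measure.pi fun _ : Edge d L => haarProbability G)) /
          ((∫ V, ∏ p ∈ B, w (plaquetteHolonomy V p.1 p.2.1.1 p.2.1.2)
            ∂(Measure.pi fun _ : Edge d L => haarProbability G)) *
            ∏ p ∈ Finset.univ \ B, w (plaquetteHolonomy U p.1 p.2.1.1 p.2.1.2)))⁻¹))]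
    (Khat : Kernel (GaugeConfig d L G × GaugeConfig d L G) (GaugeConfig d L G × GaugeConfig d L G))
    [IsMarkovKernel Khat]
    (hK : ∀ z : GaugeConfig d L G × GaugeConfig d L G, Khat z =
      (q.prod (volume : Measure unitInterval)).map (fun p : GaugeConfig d L G × unitInterval =>
        ((if (p.2 : ℝ) * (fun U =>
        ((∫ V, ∏ p : Plaquette d L, w (plaquetteHolonomy V p.1 p.2.1.1 p.2.1.2) ∂(Measure.pi fun _ : Edge d L => haarProbability G)) /
          ((∫ V, ∏ p ∈ B, w (plaquetteHolonomy V p.1 p.2.1.1 p.2.1.2)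
            ∂(Measure.pi fun _ : Edge d L => haarProbability G)) *
            ∏ p ∈ Finset.univ \ B, w (plaquetteHolonomy U p.1 p.2.1.1 p.2.1.2)))⁻¹) z.1 ≤ (fun U =>
        ((∫ V, ∏ p : Plaquette d L, w (plaquetteHolonomy V p.1 p.2.1.1 p.2.1.2) ∂(Measure.pi fun _ : Edge d L => haarProbability G)) /
          ((∫ V, ∏ p ∈ B, w (plaquetteHolonomy V p.1 p.2.1.1 p.2.1.2)
            ∂(Measure.pi fun _ : Edge d L => haarProbability G)) *
            ∏ p ∈ Finset.univ \ B, w (plaquetteHolonomy U p.1 p.2.1.1 p.2.1.2)))⁻¹) p.1 then p.1 else z.1),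
          (if (p.2 : ℝ) * (fun U =>
        ((∫ V, ∏ p : Plaquette d L, w (plaquetteHolonomy V p.1 p.2.1.1 p.2.1.2) ∂(Measure.pi fun _ : Edge d L => haarProbability G)) /
          ((∫ V, ∏ p ∈ B, w (plaquetteHolonomy V p.1 p.2.1.1 p.2.1.2)
            ∂(Measure.pi fun _ : Edge d L => haarProbability G)) *
            ∏ p ∈ Finset.univ \ B, w (plaquetteHolonomy U p.1 p.2.1.1 p.2.1.2)))⁻¹) z.2 ≤ (fun U =>
        ((∫ V, ∏ p : Plaquette d L, w (plaquetteHolonomy V p.1 p.2.1.1 p.2.1.2) ∂(Measure.pi fun _ : Edge d L => haarProbability G)) /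
          ((∫ V, ∏ p ∈ B, w (plaquetteHolonomy V p.1 p.2.1.1 p.2.1.2)
            ∂(Measure.pi fun _ : Edge d L => haarProbability G)) *
            ∏ p ∈ Finset.univ \ B, w (plaquetteHolonomy U p.1 p.2.1.1 p.2.1.2)))⁻¹) p.1 then p.1 else z.2))))
(μ₀ : Measure (GaugeConfig d L G × GaugeConfig d L G)) [IsProbabilityMeasure μ₀] (b : ℕ) {F : (ℕ → GaugeConfig d L G) → ℝ} (hF : Measurable F)
    {a c : ℝ} (ha : ∀ x, a ≤ F x) (hc : ∀ x, F x ≤ c) :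
    ∫ z, |F (fun n => (z (b + n)).1) - F (fun n => (z (b + n)).2)| ∂(Kernel.trajMeasure (X := fun _ : ℕ => GaugeConfig d L G × GaugeConfig d L G) μ₀
          (fun n : ℕ => Khat.comap (fun h : (i : ↥(Finset.Iic n)) → GaugeConfig d L G × GaugeConfig d L G => h ⟨n, Finset.mem_Iic.2 le_rfl⟩)
            (measurable_pi_apply _))) ≤
      (1 - (((∫ V, ∏ p : Plaquette d L, w (plaquetteHolonomy V p.1 p.2.1.1 p.2.1.2) ∂(Measure.pi fun _ : Edge d L => haarProbability G)) /
        ((∫ g, w g ∂(haarProbability G)) ^ B.card * M ^ (Finset.univ \ B).card)))) ^ b * μ₀.real (Set.diagonal (GaugeConfig d L G))ᶜ * (c - a) := by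
  obtain ⟨hA, hρq, hmax, hρm, hρpos⟩ := heatBath_cold_acceptMass_eq hL hw hm0 hm hM hw1 B t ht rank hrank π q hπ hq
  set cold : GaugeConfig d L G := fun _ => (1 : G) with hcold
  set ρ : GaugeConfig d L G → ℝ := fun U => ((∫ V, ∏ p : Plaquette d L, w (plaquetteHolonomy V p.1 p.2.1.1 p.2.1.2) ∂(Measure.pi fun _ : Edge d L => haarProbability G)) /
          ((∫ V, ∏ p ∈ B, w (plaquetteHolonomy V p.1 p.2.1.1 p.2.1.2)
            ∂(Measure.pi fun _ : Edge d L => haarProbability G)) *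
            ∏ p ∈ Finset.univ \ B, w (plaquetteHolonomy U p.1 p.2.1.1 p.2.1.2))) with hρ
  have hw0' : ∀ U, 0 < (ρ U)⁻¹ := fun U => inv_pos.2 (hρpos U)
  have hπ' : (q.withDensity fun U => ENNReal.ofReal (ρ U)⁻¹) = π := withDensity_inv_density hρm hρpos hρq
  haveI : IsProbabilityMeasure (q.withDensity fun U => ENNReal.ofReal (ρ U)⁻¹) := by rw [hπ']; infer_instance
  have hone : ∫⁻ y, ENNReal.ofReal (ρ y)⁻¹ ∂q = ENNReal.ofReal 1 := by
    have h : π Set.univ = 1 := measure_univ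
    rw [← hπ', withDensity_apply _ MeasurableSet.univ, Measure.restrict_univ] at h
    rw [h, ENNReal.ofReal_one]
  have hA' := imhAcceptMass_toReal_eq_of_forall_le (q := q) hw0' cold hmax zero_le_one hone
  have hrate : ((ρ cold)⁻¹)⁻¹ = ((∫ V, ∏ p : Plaquette d L, w (plaquetteHolonomy V p.1 p.2.1.1 p.2.1.2) ∂(Measure.pi fun _ : Edge d L => haarProbability G)) /
        ((∫ g, w g ∂(haarProbability G)) ^ B.card * M ^ (Finset.univ \ B).card)) := by
    rw [← hA, hA', one_div]
  have hwm : Measurable fun U => (ρ U)⁻¹ := hρm.inv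
  have h := crn_chain_path_integral_abs_sub_le_init (q := q) hwm hw0' hmax Khat hK μ₀ b hF ha hc (x₀ := cold)
  rw [hrate] at h
  exact h

/-- **`E(F(U_{b+·}) − F(U′_{b+·}))² ≤ (1 − A)^b·P(U_0 ≠ U′_0)·(c − a)²`** on the pair path law (the exact one-plaquette heat-bath sampler (`A = Z/(c^{#B}M^k)`); Hausdorff `G`). [ours] -/
theorem heatBath_crn_path_statistic_sq_diff_le [T2Space G] [MeasurableSingletonClass G] (hL : 2 ≤ L) {w : G → ℝ} (hw : Continuous w) {m M : ℝ} (hm0 : 0 < m)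
    (hm : ∀ g, m ≤ w g) (hM : ∀ g, w g ≤ M) (hw1 : w 1 = M)
    (B : Finset (Plaquette d L)) (t : Plaquette d L → Edge d L)
    (ht : ∀ p ∈ B, t p ∈ ({(p.1, p.2.1.1), (p.1.shift p.2.1.1, p.2.1.2),
        (p.1.shift p.2.1.2, p.2.1.1), (p.1, p.2.1.2)} : Finset (Edge d L)))
    (rank : Plaquette d L → ℕ)
    (hrank : ∀ p ∈ B, ∀ p' ∈ B, p ≠ p' → t p ∈ ({(p'.1, p'.2.1.1), (p'.1.shift p'.2.1.1, p'.2.1.2),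
        (p'.1.shift p'.2.1.2, p'.2.1.1), (p'.1, p'.2.1.2)} : Finset (Edge d L)) → rank p < rank p')
    (π q : Measure (GaugeConfig d L G)) [IsProbabilityMeasure π] [IsProbabilityMeasure q]
    (hπ : π = (Measure.pi fun _ : Edge d L => haarProbability G).withDensity fun U =>
      ENNReal.ofReal ((∏ p : Plaquette d L, w (plaquetteHolonomy U p.1 p.2.1.1 p.2.1.2)) /
        ∫ V, ∏ p : Plaquette d L, w (plaquetteHolonomy V p.1 p.2.1.1 p.2.1.2)
          ∂(Measure.pi fun _ : Edge d L => haarProbability G)))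
    (hq : q = (Measure.pi fun _ : Edge d L => haarProbability G).withDensity fun U =>
      ENNReal.ofReal ((∏ p ∈ B, w (plaquetteHolonomy U p.1 p.2.1.1 p.2.1.2)) /
        ∫ V, ∏ p ∈ B, w (plaquetteHolonomy V p.1 p.2.1.1 p.2.1.2)
          ∂(Measure.pi fun _ : Edge d L => haarProbability G)))
    [Fact (Measurable (fun U =>
        ((∫ V, ∏ p : Plaquette d L, w (plaquetteHolonomy V p.1 p.2.1.1 p.2.1.2) ∂(Measure.pi fun _ : Edge d L => haarProbability G)) /
          ((∫ V, ∏ p ∈ B, w (plaquetteHolonomy V p.1 p.2.1.1 p.2.1.2)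
            ∂(Measure.pi fun _ : Edge d L => haarProbability G)) *
            ∏ p ∈ Finset.univ \ B, w (plaquetteHolonomy U p.1 p.2.1.1 p.2.1.2)))⁻¹))]
    (Khat : Kernel (GaugeConfig d L G × GaugeConfig d L G) (GaugeConfig d L G × GaugeConfig d L G))
    [IsMarkovKernel Khat]
    (hK : ∀ z : GaugeConfig d L G × GaugeConfig d L G, Khat z =
      (q.prod (volume : Measure unitInterval)).map (fun p : GaugeConfig d L G × unitInterval =>
        ((if (p.2 : ℝ) * (fun U =>
        ((∫ V, ∏ p : Plaquette d L, w (plaquetteHolonomy V p.1 p.2.1.1 p.2.1.2) ∂(Measure.pi fun _ : Edge d L => haarProbability G)) /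
          ((∫ V, ∏ p ∈ B, w (plaquetteHolonomy V p.1 p.2.1.1 p.2.1.2)
            ∂(Measure.pi fun _ : Edge d L => haarProbability G)) *
            ∏ p ∈ Finset.univ \ B, w (plaquetteHolonomy U p.1 p.2.1.1 p.2.1.2)))⁻¹) z.1 ≤ (fun U =>
        ((∫ V, ∏ p : Plaquette d L, w (plaquetteHolonomy V p.1 p.2.1.1 p.2.1.2) ∂(Measure.pi fun _ : Edge d L => haarProbability G)) /
          ((∫ V, ∏ p ∈ B, w (plaquetteHolonomy V p.1 p.2.1.1 p.2.1.2)
            ∂(Measure.pi fun _ : Edge d L => haarProbability G)) *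
            ∏ p ∈ Finset.univ \ B, w (plaquetteHolonomy U p.1 p.2.1.1 p.2.1.2)))⁻¹) p.1 then p.1 else z.1),
          (if (p.2 : ℝ) * (fun U =>
        ((∫ V, ∏ p : Plaquette d L, w (plaquetteHolonomy V p.1 p.2.1.1 p.2.1.2) ∂(Measure.pi fun _ : Edge d L => haarProbability G)) /
          ((∫ V, ∏ p ∈ B, w (plaquetteHolonomy V p.1 p.2.1.1 p.2.1.2)
            ∂(Measure.pi fun _ : Edge d L => haarProbability G)) *
            ∏ p ∈ Finset.univ \ B, w (plaquetteHolonomy U p.1 p.2.1.1 p.2.1.2)))⁻¹) z.2 ≤ (fun U =>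
        ((∫ V, ∏ p : Plaquette d L, w (plaquetteHolonomy V p.1 p.2.1.1 p.2.1.2) ∂(Measure.pi fun _ : Edge d L => haarProbability G)) /
          ((∫ V, ∏ p ∈ B, w (plaquetteHolonomy V p.1 p.2.1.1 p.2.1.2)
            ∂(Measure.pi fun _ : Edge d L => haarProbability G)) *
            ∏ p ∈ Finset.univ \ B, w (plaquetteHolonomy U p.1 p.2.1.1 p.2.1.2)))⁻¹) p.1 then p.1 else z.2))))
(μ₀ : Measure (GaugeConfig d L G × GaugeConfig d L G)) [IsProbabilityMeasure μ₀] (b : ℕ) {F : (ℕ → GaugeConfig d L G) → ℝ} (hF : Measurable F)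
    {a c : ℝ} (ha : ∀ x, a ≤ F x) (hc : ∀ x, F x ≤ c) :
    ∫ z, (F (fun n => (z (b + n)).1) - F (fun n => (z (b + n)).2)) ^ 2 ∂(Kernel.trajMeasure (X := fun _ : ℕ => GaugeConfig d L G × GaugeConfig d L G) μ₀
          (fun n : ℕ => Khat.comap (fun h : (i : ↥(Finset.Iic n)) → GaugeConfig d L G × GaugeConfig d L G => h ⟨n, Finset.mem_Iic.2 le_rfl⟩)
            (measurable_pi_apply _))) ≤
      (1 - (((∫ V, ∏ p : Plaquette d L, w (plaquetteHolonomy V p.1 p.2.1.1 p.2.1.2) ∂(Measure.pi fun _ : Edge d L => haarProbability G)) /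
        ((∫ g, w g ∂(haarProbability G)) ^ B.card * M ^ (Finset.univ \ B).card)))) ^ b * μ₀.real (Set.diagonal (GaugeConfig d L G))ᶜ * (c - a) ^ 2 := by
  obtain ⟨hA, hρq, hmax, hρm, hρpos⟩ := heatBath_cold_acceptMass_eq hL hw hm0 hm hM hw1 B t ht rank hrank π q hπ hq
  set cold : GaugeConfig d L G := fun _ => (1 : G) with hcold
  set ρ : GaugeConfig d L G → ℝ := fun U => ((∫ V, ∏ p : Plaquette d L, w (plaquetteHolonomy V p.1 p.2.1.1 p.2.1.2) ∂(Measure.pi fun _ : Edge d L => haarProbability G)) /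
          ((∫ V, ∏ p ∈ B, w (plaquetteHolonomy V p.1 p.2.1.1 p.2.1.2)
            ∂(Measure.pi fun _ : Edge d L => haarProbability G)) *
            ∏ p ∈ Finset.univ \ B, w (plaquetteHolonomy U p.1 p.2.1.1 p.2.1.2))) with hρ
  have hw0' : ∀ U, 0 < (ρ U)⁻¹ := fun U => inv_pos.2 (hρpos U)
  have hπ' : (q.withDensity fun U => ENNReal.ofReal (ρ U)⁻¹) = π := withDensity_inv_density hρm hρpos hρq
  haveI : IsProbabilityMeasure (q.withDensity fun U => ENNReal.ofReal (ρ U)⁻¹) := by rw [hπ']; infer_instance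
  have hone : ∫⁻ y, ENNReal.ofReal (ρ y)⁻¹ ∂q = ENNReal.ofReal 1 := by
    have h : π Set.univ = 1 := measure_univ
    rw [← hπ', withDensity_apply _ MeasurableSet.univ, Measure.restrict_univ] at h
    rw [h, ENNReal.ofReal_one]
  have hA' := imhAcceptMass_toReal_eq_of_forall_le (q := q) hw0' cold hmax zero_le_one hone
  have hrate : ((ρ cold)⁻¹)⁻¹ = ((∫ V, ∏ p : Plaquette d L, w (plaquetteHolonomy V p.1 p.2.1.1 p.2.1.2) ∂(Measure.pi fun _ : Edge d L => haarProbability G)) /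
        ((∫ g, w g ∂(haarProbability G)) ^ B.card * M ^ (Finset.univ \ B).card)) := by
    rw [← hA, hA', one_div]
  have hwm : Measurable fun U => (ρ U)⁻¹ := hρm.inv
  have h := crn_chain_path_integral_sq_sub_le_init (q := q) hwm hw0' hmax Khat hK μ₀ b hF ha hc (x₀ := cold)
  rw [hrate] at h
  exact h

/-- **THE COUPLING INEQUALITY**: `|E F(U_{b+·}) − E F(V_{b+·})| ≤ (1 − A)^b·μ̂₀(Δᶜ)·(c − a)` for the runs from the two marginals of any `μ̂₀` (the exact one-plaquette heat-bath sampler (`A = Z/(c^{#B}M^k)`); Hausdorff `G`). [ours] -/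
theorem heatBath_coupling_inequality [T2Space G] [MeasurableSingletonClass G] (hL : 2 ≤ L) {w : G → ℝ} (hw : Continuous w) {m M : ℝ} (hm0 : 0 < m)
    (hm : ∀ g, m ≤ w g) (hM : ∀ g, w g ≤ M) (hw1 : w 1 = M)
    (B : Finset (Plaquette d L)) (t : Plaquette d L → Edge d L)
    (ht : ∀ p ∈ B, t p ∈ ({(p.1, p.2.1.1), (p.1.shift p.2.1.1, p.2.1.2),
        (p.1.shift p.2.1.2, p.2.1.1), (p.1, p.2.1.2)} : Finset (Edge d L)))
    (rank : Plaquette d L → ℕ)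
    (hrank : ∀ p ∈ B, ∀ p' ∈ B, p ≠ p' → t p ∈ ({(p'.1, p'.2.1.1), (p'.1.shift p'.2.1.1, p'.2.1.2),
        (p'.1.shift p'.2.1.2, p'.2.1.1), (p'.1, p'.2.1.2)} : Finset (Edge d L)) → rank p < rank p')
    (π q : Measure (GaugeConfig d L G)) [IsProbabilityMeasure π] [IsProbabilityMeasure q]
    (hπ : π = (Measure.pi fun _ : Edge d L => haarProbability G).withDensity fun U =>
      ENNReal.ofReal ((∏ p : Plaquette d L, w (plaquetteHolonomy U p.1 p.2.1.1 p.2.1.2)) /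
        ∫ V, ∏ p : Plaquette d L, w (plaquetteHolonomy V p.1 p.2.1.1 p.2.1.2)
          ∂(Measure.pi fun _ : Edge d L => haarProbability G)))
    (hq : q = (Measure.pi fun _ : Edge d L => haarProbability G).withDensity fun U =>
      ENNReal.ofReal ((∏ p ∈ B, w (plaquetteHolonomy U p.1 p.2.1.1 p.2.1.2)) /
        ∫ V, ∏ p ∈ B, w (plaquetteHolonomy V p.1 p.2.1.1 p.2.1.2)
          ∂(Measure.pi fun _ : Edge d L => haarProbability G)))
    [Fact (Measurable (fun U =>
        ((∫ V, ∏ p : Plaquette d L, w (plaquetteHolonomy V p.1 p.2.1.1 p.2.1.2) ∂(Measure.pi fun _ : Edge d L => haarProbability G)) /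
          ((∫ V, ∏ p ∈ B, w (plaquetteHolonomy V p.1 p.2.1.1 p.2.1.2)
            ∂(Measure.pi fun _ : Edge d L => haarProbability G)) *
            ∏ p ∈ Finset.univ \ B, w (plaquetteHolonomy U p.1 p.2.1.1 p.2.1.2)))⁻¹))]
(μ₀ : Measure (GaugeConfig d L G × GaugeConfig d L G)) [IsProbabilityMeasure μ₀] (b : ℕ) {F : (ℕ → GaugeConfig d L G) → ℝ} (hF : Measurable F)
    {a c : ℝ} (ha : ∀ x, a ≤ F x) (hc : ∀ x, F x ≤ c) :
    |∫ x, F (fun n => x (b + n)) ∂(Kernel.trajMeasure (X := fun _ : ℕ => GaugeConfig d L G) (μ₀.map Prod.fst)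
        (fun n : ℕ => (indepMH q (fun U =>
        ((∫ V, ∏ p : Plaquette d L, w (plaquetteHolonomy V p.1 p.2.1.1 p.2.1.2) ∂(Measure.pi fun _ : Edge d L => haarProbability G)) /
          ((∫ V, ∏ p ∈ B, w (plaquetteHolonomy V p.1 p.2.1.1 p.2.1.2)
            ∂(Measure.pi fun _ : Edge d L => haarProbability G)) *
            ∏ p ∈ Finset.univ \ B, w (plaquetteHolonomy U p.1 p.2.1.1 p.2.1.2)))⁻¹)).comap (fun h : (i : ↥(Finset.Iic n)) → GaugeConfig d L G => h ⟨n, Finset.mem_Iic.2 le_rfl⟩)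
          (measurable_pi_apply _))) -
      ∫ x, F (fun n => x (b + n)) ∂(Kernel.trajMeasure (X := fun _ : ℕ => GaugeConfig d L G) (μ₀.map Prod.snd)
        (fun n : ℕ => (indepMH q (fun U =>
        ((∫ V, ∏ p : Plaquette d L, w (plaquetteHolonomy V p.1 p.2.1.1 p.2.1.2) ∂(Measure.pi fun _ : Edge d L => haarProbability G)) /
          ((∫ V, ∏ p ∈ B, w (plaquetteHolonomy V p.1 p.2.1.1 p.2.1.2)
            ∂(Measure.pi fun _ : Edge d L => haarProbability G)) *
            ∏ p ∈ Finset.univ \ B, w (plaquetteHolonomy U p.1 p.2.1.1 p.2.1.2)))⁻¹)).comap (fun h : (i : ↥(Finset.Iic n)) → GaugeConfig d L G => h ⟨n, Finset.mem_Iic.2 le_rfl⟩)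
          (measurable_pi_apply _)))| ≤
      (1 - (((∫ V, ∏ p : Plaquette d L, w (plaquetteHolonomy V p.1 p.2.1.1 p.2.1.2) ∂(Measure.pi fun _ : Edge d L => haarProbability G)) /
        ((∫ g, w g ∂(haarProbability G)) ^ B.card * M ^ (Finset.univ \ B).card)))) ^ b * μ₀.real (Set.diagonal (GaugeConfig d L G))ᶜ * (c - a) := by
  obtain ⟨hA, hρq, hmax, hρm, hρpos⟩ := heatBath_cold_acceptMass_eq hL hw hm0 hm hM hw1 B t ht rank hrank π q hπ hq
  set cold : GaugeConfig d L G := fun _ => (1 : G) with hcold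
  set ρ : GaugeConfig d L G → ℝ := fun U => ((∫ V, ∏ p : Plaquette d L, w (plaquetteHolonomy V p.1 p.2.1.1 p.2.1.2) ∂(Measure.pi fun _ : Edge d L => haarProbability G)) /
          ((∫ V, ∏ p ∈ B, w (plaquetteHolonomy V p.1 p.2.1.1 p.2.1.2)
            ∂(Measure.pi fun _ : Edge d L => haarProbability G)) *
            ∏ p ∈ Finset.univ \ B, w (plaquetteHolonomy U p.1 p.2.1.1 p.2.1.2))) with hρ
  have hw0' : ∀ U, 0 < (ρ U)⁻¹ := fun U => inv_pos.2 (hρpos U)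
  have hπ' : (q.withDensity fun U => ENNReal.ofReal (ρ U)⁻¹) = π := withDensity_inv_density hρm hρpos hρq
  haveI : IsProbabilityMeasure (q.withDensity fun U => ENNReal.ofReal (ρ U)⁻¹) := by rw [hπ']; infer_instance
  have hone : ∫⁻ y, ENNReal.ofReal (ρ y)⁻¹ ∂q = ENNReal.ofReal 1 := by
    have h : π Set.univ = 1 := measure_univ
    rw [← hπ', withDensity_apply _ MeasurableSet.univ, Measure.restrict_univ] at h
    rw [h, ENNReal.ofReal_one]
  have hA' := imhAcceptMass_toReal_eq_of_forall_le (q := q) hw0' cold hmax zero_le_one hone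
  have hrate : ((ρ cold)⁻¹)⁻¹ = ((∫ V, ∏ p : Plaquette d L, w (plaquetteHolonomy V p.1 p.2.1.1 p.2.1.2) ∂(Measure.pi fun _ : Edge d L => haarProbability G)) /
        ((∫ g, w g ∂(haarProbability G)) ^ B.card * M ^ (Finset.univ \ B).card)) := by
    rw [← hA, hA', one_div]
  have h := imh_chain_shift_integral_sub_le_of_coupling (q := q) hw0' hmax μ₀ b hF ha hc (x₀ := cold)
  rw [hrate] at h
  exact h

end Summit.Ventures.LatticeQCDFlow.Theory2.Autoregressive

end
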